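import Literature.MathematicalPhysics.QuantumFieldTheory.Balaban1983to89.B8Eq191FlatDirichletCoercive
import Literature.MathematicalPhysics.QuantumFieldTheory.Balaban1983to89.B8TowerBondsLayerLawSubD

/-!
# `Balaban1983to89.B8Eq191FlatCoerciveZdOfLamTop` — [Balaban1985BackgroundPropagators] (3.23)–(3.24) p. 394 ∕ Thm 3.1 p. 397 (its first input), flat background, AT THE `ℤᵈ`
# CARRIER: the multi-level form `Δ^η + Q′*𝔄Q′` is COERCIVE on every finitely supported real source at EVERY (1.3)–(1.5)-admissible `Ω₀ = ℤᵈ` law member — dag-n05-c's weighted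
# block inequality `B8Eq191FlatDirichletCoercive.weighted_coercive_flatDirichlet_uniform` (arbitrary finite `S`) applied at the tower-block hull of the support, its two geometric
# hypotheses DISCHARGED by print's (1.5)–(1.6) (the disjointness `towers_disjoint_of_lamTop_blockMap` and the cover `ZdIdx.hpart`)

statement-level skeleton of published theorems with citation tags; proofs where landed; nothing here is a claim about the Yang–Mills mass gap

`[Balaban1985BackgroundPropagators]` ("[4]"; journal page = PDF page + 388): (3.23)–(3.24) p. 394 (`Δ^η`, `Q′*𝔄Q′` with the positive level weights `a_j(Lʲη)^{d−2}`), Thm 3.1 p. 397.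
`[Balaban1984PropagatorsII]` ("B6"): (2.26)–(2.27) p. 235 (the block inequality).  `[Balaban1985RegularSpaces]` ("B8"): (1.3)–(1.6) p. 77 («Λ_j = Ω_j^{(j)} ∖ Ω_{j+1}^{(j)}»,
«Ω = ⋃_j Bʲ(Λ_j)»), p. 77 («we admit Ω_j = T_η»), (1.91) p. 91.

## WHY THIS FILE (cell `pub-ymgap`, HUMAN RULING D-0062; width seat `pub-ymgap-dag-n05-w1` g3, DAG node N05 = [B8]; proof lane, count-neutral)

dag-n05-d g13's LOCATED JUNCTION ROAD NOTE (2026-08-28 11:04Z) and dag-n06-b g21's WORD to this seat (12:27Z): the N05 row's [4]-letters at the `Ω₀ = ℤᵈ` members need an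
`ℓ^∞(ℤᵈ, 𝔸)` letter layer whose first brick is «block Poincaré ∕ coercivity of `Δ^η_{U₀} + Q′*𝔄Q′` on `ℓ²(ℤᵈ)`, flat first» — «the per-block inequality is landed carrier-free …
finite-member flat coercivity exists … an `ℓ²(ℤᵈ)` edition = sum the block Poincaré over the `Lᵐ`-block partition of `ℤᵈ` — S∕M-sized, no new idea».  dag-n05-c's
`weighted_coercive_flatDirichlet_uniform` already sums (2.27) over the tower blocks inside an ARBITRARY finite `S ⊂ ℤᵈ`, under two displayed geometric hypotheses: `hfull`
(every tower block meeting `S` lies in `S`) and `hdisj` (a site of `S` lies in at most one tower block).  At a (1.5)-member BOTH hold for `S :=` the union of the tower blocks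
through the (finite) support of the source: `hdisj` IS print's (1.5) (dag-n05-c's `towers_disjoint_of_lamTop_blockMap`, the same fact this seat's interpolation letter rests on),
`hfull` is the construction, and the cover (1.6) (`ZdIdx.hpart`) puts every site of the support in a tower block, so the left side dominates `a₀(Lᵏη)⁻²·Σ_x v(x)²`.

## WHAT IS PROVED (kernel, 0 sorry, 0 def)

* §1 plumbing: `exists_towerSite_of_mem` (the cover at the top truncation in block-label spelling), `towerHull` built inline as a `Finset.biUnion` of `blockSites`.
* §2 ★★ `flat_coercive_zd_of_lamTop` — `L ≥ 1`, `η ≠ 0`, a lawful (1.3)–(1.5)-admissible member `i`, print's-shape weights with one `a₀ ≤ 8` below `a_j η² L^{2j} L^{−dj}` (`j ≤ k`), the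
  flat form `K` of `B8Eq191FlatDirichletCoercive` (any kernel with the displayed formula), a finite `S₀` and a real `v` vanishing off `S₀` ⊢ with `S :=` the tower-block hull of `S₀`:
  `a₀ · Σ_{j ≤ k} (Lʲη)⁻² Σ_{x∈S : Bʲ(x)∈Λ_j} v(x)² ≤ Σ_{x,z∈S} v(x)K(x,z)v(z)`; ★★ `flat_coercive_zd_of_lamTop_norm` — the `ℓ²` form `a₀ · (Lᵏη)⁻² · Σ_{x∈S₀} v(x)² ≤ ⟨v, Kv⟩_S`.
* §3 `IdxB8SubD.flat_coercive_zd_norm` — on the index of record.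

## HONEST SCOPE

FLAT background (`U₀ = 1`); REAL scalar sources (the `𝔸`-valued ∕ trace edition is a componentwise reduction for the N06 frame owners); FINITELY SUPPORTED sources (the `ℓ²`
closure, Lax–Milgram, decay and the `ℓ²→ℓ^∞` step of [4] Thm 3.1 are NOT here); constant `a₀(Lᵏη)⁻²` (level weights as printed); 0 new estimate — the ℤᵈ-carrier bookkeeping
over dag-n05-c's (2.27) assembly.  Count-neutral; N05 ∕ N06 NOT discharged; no count claim; `T_η ↦ ℤᵈ`; one finite `𝕋⁴` programme at fixed `ε`, Bałaban as printed — the Yang–Mills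
mass gap (Clay) is NOT proved by any of this; R4 closes the conditional finite-`𝕋⁴` rung `BalabanLadder.UV` only; nothing continuum ∕ ℝ⁴ ∕ OS.  Unit `pub-ymgap-dag-n05-w1` (g3).

[cite: Balaban1985BackgroundPropagators, (3.23)–(3.24) p.394, Thm 3.1 p.397; Balaban1984PropagatorsII, (2.26)–(2.27) p.235; Balaban1985RegularSpaces, (1.3)–(1.6) p.77, (1.91) p.91]
-/

noncomputable section

namespace Literature.MathematicalPhysics.QuantumFieldTheory.Balaban1983to89.B8Eq191FlatCoerciveZdOfLamTop

open Finset
open B7Prop1Explicit (e)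
open Literature.MathematicalPhysics.QuantumLattice (blockMap blockSites mem_blockSites_iff)
open B8LeafModelZd (ZdIdx)
open B8ConstraintBonds (DomainSeq Lam)
open B8CubeMemberZd (inBox_tower_iff_under)
open B8Eq191FlatLettersCubeMember (under_iff_blockMap_eq)
open B8IdxB8LamTopTowerDisjoint (towers_disjoint_of_lamTop_blockMap)
open B8Eq191FlatDirichletCoercive (weighted_coercive_flatDirichlet_uniform)
open Node00 (Stage3Params IdxB8Laws IdxB8SubD)

-- `Site` alone could resolve to the torus sites of `Setup.lean`; re-export the `ℤ^d` sites of `B7Prop1Explicit`.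
export B7Prop1Explicit (Site)

variable {d : ℕ}

/-! ## §1 The cover at the top truncation, block-label spelling -/

/-- **(1.6) at the top truncation, block labels**: at a member with `Ω₀ = ℤᵈ`, every fine site lies under SOME constraint point `(j, y)`, `j ≤ k`, `y ∈ Λs k j`, i.e.
`blockMap (Lʲ) x ∈ Λs k j` (`ZdIdx.hpart`). [cite: Balaban1985RegularSpaces, (1.6) p.77 («Ω = ⋃_j Bʲ(Λ_j)»)] -/
theorem exists_towerSite_of_mem {L : ℕ} (hL : 1 ≤ L) (i : ZdIdx d L) (hΩ0 : i.Ω 0 = Set.univ) (x : Site d) :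
    ∃ j, j ≤ i.k ∧ blockMap (L ^ j) x ∈ i.Λs i.k j := by
  obtain ⟨j, hj, y, hy, hx⟩ := i.hpart x (by rw [hΩ0]; exact Set.mem_univ x)
  have hxy : blockMap (L ^ j) x = y := (under_iff_blockMap_eq hL j y x).1 ((inBox_tower_iff_under L j y x).1 hx)
  exact ⟨j, hj, by rw [hxy]; exact hy⟩

/-! ## §2 Coercivity of the flat multi-level form at the `ℤᵈ` carrier -/

section Coercive

open Classical in
/-- ★★ **FLAT COERCIVITY AT THE `ℤᵈ` CARRIER FOR EVERY (1.3)–(1.5)-ADMISSIBLE LAW MEMBER**: `L ≥ 1`, `η ≠ 0`, `i : ZdIdx d L` with `Ω₀ = ℤᵈ`, NODE 00's located laws, (1.3)–(1.4)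
and the (1.5) face; the flat multi-level form `K = η⁻²(−Δ) + Σ_{j≤k} a_j L^{−2dj}·𝟙[same Λ_j-block]` (any kernel with this formula); one constant `a₀ ≤ 8` below the printed-shape
weights, `a₀ ≤ a_j η² L^{2j} L^{−dj}` (`j ≤ k`); a finite `S₀ ⊂ ℤᵈ` and a real `v` vanishing off `S₀`.  Then, with `S :=` the union of the tower blocks through `S₀`,
`a₀ · Σ_{j≤k} (Lʲη)⁻² · Σ_{x∈S : Bʲ(x)∈Λ_j} v(x)² ≤ Σ_{x,z∈S} v(x)K(x,z)v(z)` — dag-n05-c's `weighted_coercive_flatDirichlet_uniform` with `hfull` (the hull is a union of blocks) and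
`hdisj` ((1.5): `towers_disjoint_of_lamTop_blockMap`) DISCHARGED. [cite: Balaban1985BackgroundPropagators, (3.23)–(3.24) p.394, Thm 3.1 p.397; Balaban1984PropagatorsII, (2.26)–(2.27) p.235; Balaban1985RegularSpaces, (1.5)–(1.6) p.77] -/
theorem flat_coercive_zd_of_lamTop {η : ℝ} (hη : η ≠ 0) {L : ℕ} (hL : 1 ≤ L) (i : ZdIdx d L) (hΩ0 : i.Ω 0 = Set.univ) (hlaws : IdxB8Laws L i) (hΩ : DomainSeq L i.Ω)
    (hΛ : ∀ j, j < i.k → ∀ z ∈ i.Λs i.k j, ((L : ℤ) ^ j) • z ∈ Lam L i.Ω j)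
    (a : ℕ → ℝ) (K : Site d → Site d → ℝ)
    (hK : ∀ x z, K x z = ((η ^ 2)⁻¹ * ∑ μ : Fin d, ((2 : ℝ) * (if z = x then (1 : ℝ) else 0) - (if z = x + e μ then (1 : ℝ) else 0)
        - (if z = x - e μ then (1 : ℝ) else 0))) +
        (∑ j ∈ Finset.range (i.k + 1), (if blockMap (L ^ j) x ∈ i.Λs i.k j ∧ blockMap (L ^ j) z = blockMap (L ^ j) x then
          a j * ((((L : ℝ) ^ d)⁻¹) ^ j) ^ 2 else 0)))
    {a₀ : ℝ} (ha₀ : a₀ ≤ 8) (ha : ∀ j, j ≤ i.k → a₀ ≤ a j * η ^ 2 * ((L : ℝ) ^ j) ^ 2 * (((L : ℝ) ^ d) ^ j)⁻¹)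
    (S₀ : Finset (Site d)) (v : Site d → ℝ) (hv : ∀ w, w ∉ S₀ → v w = 0) :
    ∃ S : Finset (Site d), S₀ ⊆ S ∧ (∀ w, w ∉ S → v w = 0) ∧
      a₀ * ∑ j ∈ Finset.range (i.k + 1), (((L : ℝ) ^ j * η) ^ 2)⁻¹ * ∑ x ∈ S.filter (fun x => blockMap (L ^ j) x ∈ i.Λs i.k j), v x ^ 2
        ≤ ∑ x ∈ S, ∑ z ∈ S, v x * K x z * v z := by
  classical
  -- the level and label of the tower block through a site (the cover (1.6))
  have hcov := exists_towerSite_of_mem hL i hΩ0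
  let lev : Site d → ℕ := fun x => (hcov x).choose
  have hlev : ∀ x, lev x ≤ i.k ∧ blockMap (L ^ lev x) x ∈ i.Λs i.k (lev x) := fun x => (hcov x).choose_spec
  haveI : ∀ j, NeZero (L ^ j) := fun j => ⟨(pow_pos (by omega : 0 < L) j).ne'⟩
  -- the tower-block hull of `S₀`
  let S : Finset (Site d) := S₀.biUnion fun x => blockSites (L ^ lev x) (blockMap (L ^ lev x) x)
  have hS : ∀ z, z ∈ S ↔ ∃ x ∈ S₀, blockMap (L ^ lev x) z = blockMap (L ^ lev x) x := fun z => by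
    simp only [S, Finset.mem_biUnion, mem_blockSites_iff]
  have hS₀S : S₀ ⊆ S := fun x hx => (hS x).2 ⟨x, hx, rfl⟩
  have hvS : ∀ w, w ∉ S → v w = 0 := fun w hw => hv w fun h => hw (hS₀S h)
  have hdisjT := towers_disjoint_of_lamTop_blockMap hL i hlaws hΩ hΛ i.k le_rfl
  refine ⟨S, hS₀S, hvS, weighted_coercive_flatDirichlet_uniform hη hL i.k (i.Λs i.k) a K hK S v hvS ?_ ?_ ha₀ ha⟩
  · -- `hfull`: a tower block meeting the hull lies in the hull
    intro j hj x hx hxj z hz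
    obtain ⟨x₀, hx₀, hxx₀⟩ := (hS x).1 hx
    -- `x` lies in the tower block of `x₀` (level `lev x₀`) and in the tower block `(j, blockMap (Lʲ) x)`: same block
    have hsame := hdisjT (lev x₀) (hlev x₀).1 j hj _ (hlev x₀).2 _ hxj x hxx₀ rfl
    obtain ⟨rfl, hlab⟩ := hsame
    exact (hS z).2 ⟨x₀, hx₀, hz.trans hlab.symm⟩
  · -- `hdisj`: (1.5)
    intro x _ j hj j' hj' hxj hxj'
    exact (hdisjT j hj j' hj' _ hxj _ hxj' x rfl rfl).1

open Classical in
/-- ★★ **THE `ℓ²` FORM**: under the same hypotheses, `a₀ · (Lᵏη)⁻² · Σ_{x∈S₀} v(x)² ≤ Σ_{x,z∈S} v(x)K(x,z)v(z)` — every site of the support lies in exactly one tower block of some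
level `j ≤ k` (the cover (1.6) + (1.5)), and `(Lʲη)⁻² ≥ (Lᵏη)⁻²`. [cite: Balaban1985BackgroundPropagators, (3.24) p.394, Thm 3.1 p.397; Balaban1985RegularSpaces, (1.5)–(1.6) p.77] -/
theorem flat_coercive_zd_of_lamTop_norm {η : ℝ} (hη : η ≠ 0) {L : ℕ} (hL : 1 ≤ L) (i : ZdIdx d L) (hΩ0 : i.Ω 0 = Set.univ) (hlaws : IdxB8Laws L i) (hΩ : DomainSeq L i.Ω)
    (hΛ : ∀ j, j < i.k → ∀ z ∈ i.Λs i.k j, ((L : ℤ) ^ j) • z ∈ Lam L i.Ω j)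
    (a : ℕ → ℝ) (K : Site d → Site d → ℝ)
    (hK : ∀ x z, K x z = ((η ^ 2)⁻¹ * ∑ μ : Fin d, ((2 : ℝ) * (if z = x then (1 : ℝ) else 0) - (if z = x + e μ then (1 : ℝ) else 0)
        - (if z = x - e μ then (1 : ℝ) else 0))) +
        (∑ j ∈ Finset.range (i.k + 1), (if blockMap (L ^ j) x ∈ i.Λs i.k j ∧ blockMap (L ^ j) z = blockMap (L ^ j) x then
          a j * ((((L : ℝ) ^ d)⁻¹) ^ j) ^ 2 else 0)))
    {a₀ : ℝ} (ha₀0 : 0 ≤ a₀) (ha₀ : a₀ ≤ 8) (ha : ∀ j, j ≤ i.k → a₀ ≤ a j * η ^ 2 * ((L : ℝ) ^ j) ^ 2 * (((L : ℝ) ^ d) ^ j)⁻¹)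
    (S₀ : Finset (Site d)) (v : Site d → ℝ) (hv : ∀ w, w ∉ S₀ → v w = 0) :
    ∃ S : Finset (Site d), S₀ ⊆ S ∧ (∀ w, w ∉ S → v w = 0) ∧
      a₀ * (((L : ℝ) ^ i.k * η) ^ 2)⁻¹ * ∑ x ∈ S₀, v x ^ 2 ≤ ∑ x ∈ S, ∑ z ∈ S, v x * K x z * v z := by
  classical
  obtain ⟨S, hS₀S, hvS, hcoer⟩ := flat_coercive_zd_of_lamTop hη hL i hΩ0 hlaws hΩ hΛ a K hK ha₀ ha S₀ v hv
  refine ⟨S, hS₀S, hvS, le_trans ?_ hcoer⟩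
  have hL1 : (1 : ℝ) ≤ L := by exact_mod_cast hL
  have hdisjT := towers_disjoint_of_lamTop_blockMap hL i hlaws hΩ hΛ i.k le_rfl
  -- compare level weights with the top-level weight
  have hwt : ∀ j ∈ Finset.range (i.k + 1), (((L : ℝ) ^ i.k * η) ^ 2)⁻¹ ≤ (((L : ℝ) ^ j * η) ^ 2)⁻¹ := by
    intro j hj
    have hjk : j ≤ i.k := Nat.lt_succ_iff.mp (Finset.mem_range.mp hj)
    have hη2 : 0 < η ^ 2 := by positivity
    have hLj : 0 < (L : ℝ) ^ j := by positivity
    rw [mul_pow, mul_pow, mul_inv, mul_inv]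
    refine mul_le_mul_of_nonneg_right (inv_anti₀ (by positivity) ?_) (by positivity)
    exact pow_le_pow_left₀ hLj.le (pow_le_pow_right₀ hL1 hjk) 2
  -- every site of `S₀` is counted at its own level
  have hcount : ∑ x ∈ S₀, v x ^ 2 ≤ ∑ j ∈ Finset.range (i.k + 1), ∑ x ∈ S.filter (fun x => blockMap (L ^ j) x ∈ i.Λs i.k j), v x ^ 2 := by
    have hcov := exists_towerSite_of_mem hL i hΩ0
    -- rewrite the double sum as a sum over `S` of `v x² · #{levels of x}` ≥ sum over `S₀`
    have h1 : ∑ j ∈ Finset.range (i.k + 1), ∑ x ∈ S.filter (fun x => blockMap (L ^ j) x ∈ i.Λs i.k j), v x ^ 2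
        = ∑ x ∈ S, ∑ j ∈ Finset.range (i.k + 1), if blockMap (L ^ j) x ∈ i.Λs i.k j then v x ^ 2 else 0 := by
      rw [Finset.sum_comm]
      refine Finset.sum_congr rfl fun j _ => ?_
      rw [Finset.sum_filter]
    rw [h1]
    calc ∑ x ∈ S₀, v x ^ 2 ≤ ∑ x ∈ S, v x ^ 2 := Finset.sum_le_sum_of_subset_of_nonneg hS₀S fun x _ _ => sq_nonneg _
      _ ≤ ∑ x ∈ S, ∑ j ∈ Finset.range (i.k + 1), if blockMap (L ^ j) x ∈ i.Λs i.k j then v x ^ 2 else 0 := by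
          refine Finset.sum_le_sum fun x _ => ?_
          obtain ⟨j, hj, hxj⟩ := hcov x
          have hmem : j ∈ Finset.range (i.k + 1) := Finset.mem_range.mpr (Nat.lt_succ_of_le hj)
          set F : ℕ → ℝ := fun j' => if blockMap (L ^ j') x ∈ i.Λs i.k j' then v x ^ 2 else 0 with hF
          have hFnn : ∀ j' ∈ Finset.range (i.k + 1), 0 ≤ F j' := fun j' _ => by
            simp only [hF]; split_ifs
            · exact sq_nonneg _
            · exact le_rfl
          have hFj : F j = v x ^ 2 := by simp only [hF, if_pos hxj]
          calc v x ^ 2 = F j := hFj.symm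
            _ ≤ ∑ j' ∈ Finset.range (i.k + 1), F j' := Finset.single_le_sum hFnn hmem
  calc a₀ * (((L : ℝ) ^ i.k * η) ^ 2)⁻¹ * ∑ x ∈ S₀, v x ^ 2
      ≤ a₀ * (((L : ℝ) ^ i.k * η) ^ 2)⁻¹ * ∑ j ∈ Finset.range (i.k + 1), ∑ x ∈ S.filter (fun x => blockMap (L ^ j) x ∈ i.Λs i.k j), v x ^ 2 :=
        mul_le_mul_of_nonneg_left hcount (by positivity)
    _ = a₀ * ∑ j ∈ Finset.range (i.k + 1), (((L : ℝ) ^ i.k * η) ^ 2)⁻¹ * ∑ x ∈ S.filter (fun x => blockMap (L ^ j) x ∈ i.Λs i.k j), v x ^ 2 := by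
        rw [mul_assoc, Finset.mul_sum]
    _ ≤ a₀ * ∑ j ∈ Finset.range (i.k + 1), (((L : ℝ) ^ j * η) ^ 2)⁻¹ * ∑ x ∈ S.filter (fun x => blockMap (L ^ j) x ∈ i.Λs i.k j), v x ^ 2 := by
        refine mul_le_mul_of_nonneg_left (Finset.sum_le_sum fun j hj => ?_) ha₀0
        exact mul_le_mul_of_nonneg_right (hwt j hj) (Finset.sum_nonneg fun x _ => sq_nonneg _)

end Coercive

/-! ## §3 On the index of record -/

section Record

open Classical in
/-- **ON THE (1.5)-OBEYING SUB-INDEX OF RECORD** `IdxB8SubD θ`: flat coercivity of the multi-level form on every finitely supported real source at every member, in the `ℓ²` form.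
[cite: Balaban1985BackgroundPropagators, (3.23)–(3.24) p.394, Thm 3.1 p.397; Balaban1985RegularSpaces, (1.3)–(1.6) p.77] -/
theorem IdxB8SubD.flat_coercive_zd_norm {θ : Stage3Params} (j : IdxB8SubD θ) {η : ℝ} (hη : η ≠ 0)
    (a : ℕ → ℝ) (K : Site θ.D → Site θ.D → ℝ)
    (hK : ∀ x z, K x z = ((η ^ 2)⁻¹ * ∑ μ : Fin θ.D, ((2 : ℝ) * (if z = x then (1 : ℝ) else 0) - (if z = x + e μ then (1 : ℝ) else 0)
        - (if z = x - e μ then (1 : ℝ) else 0))) +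
        (∑ l ∈ Finset.range (j.1.1.1.1.k + 1), (if blockMap (θ.L ^ l) x ∈ j.1.1.1.1.Λs j.1.1.1.1.k l ∧ blockMap (θ.L ^ l) z = blockMap (θ.L ^ l) x then
          a l * ((((θ.L : ℝ) ^ θ.D)⁻¹) ^ l) ^ 2 else 0)))
    {a₀ : ℝ} (ha₀0 : 0 ≤ a₀) (ha₀ : a₀ ≤ 8) (ha : ∀ l, l ≤ j.1.1.1.1.k → a₀ ≤ a l * η ^ 2 * ((θ.L : ℝ) ^ l) ^ 2 * (((θ.L : ℝ) ^ θ.D) ^ l)⁻¹)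
    (S₀ : Finset (Site θ.D)) (v : Site θ.D → ℝ) (hv : ∀ w, w ∉ S₀ → v w = 0) :
    ∃ S : Finset (Site θ.D), S₀ ⊆ S ∧ (∀ w, w ∉ S → v w = 0) ∧
      a₀ * (((θ.L : ℝ) ^ j.1.1.1.1.k * η) ^ 2)⁻¹ * ∑ x ∈ S₀, v x ^ 2 ≤ ∑ x ∈ S, ∑ z ∈ S, v x * K x z * v z :=
  flat_coercive_zd_of_lamTop_norm hη (le_trans (by norm_num) θ.two_le_L) j.1.1.1.1 j.Ω_zero j.laws j.domainSeq j.lamTop a K hK ha₀0 ha₀ ha S₀ v hv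

end Record

end Literature.MathematicalPhysics.QuantumFieldTheory.Balaban1983to89.B8Eq191FlatCoerciveZdOfLamTop

end
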